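import Mathlib.AlgebraicGeometry.EllipticCurve.VariableChange
import Mathlib.NumberTheory.LegendreSymbol.Basic
import Mathlib.Algebra.Squarefree.Basic
import Literature.NumberTheory.EllipticCurves.GlobalMinimalModel
import HarnessLib

-- provenance: harness21/H21/H21/Prelude/TranscendEllArithS/QuadraticTwist.lean @ 92cfc90 (interim HEAD d8f2665); M5 mechanical rewrite
/-!
# Quadratic twists of Weierstrass curves

Trunk T-ELLARITH (group G06 TranscendEllArithS, outline item C20, notion `quadratic_twist`).

Let `W : y² + a₁xy + a₃y = x³ + a₂x² + a₄x + a₆` be a Weierstrass equation over a field `F` of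
characteristic `≠ 2`. Completing the square (`y ↦ y - (a₁x + a₃)/2`) gives the model
`y² = x³ + (b₂/4)x² + (b₄/2)x + b₆/4`. For `d ∈ F` the *quadratic twist* of `W` by `d` is the curve
`d y² = x³ + (b₂/4)x² + (b₄/2)x + b₆/4`, which after `(x, y) ↦ (d x, d² y)` becomes the Weierstrass
equation

`W^d : y² = x³ + d (b₂/4) x² + d² (b₄/2) x + d³ (b₆/4)`.

This file defines `WeierstrassCurve.quadraticTwist W d := W^d` and records the standard facts:
`b₂, b₄, b₆, c₄, c₆` scale by `d, d², d³, d², d³`, `Δ(W^d) = d⁶ Δ(W)`, `j(W^d) = j(W)`, `W^1 ≅ W`,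
`W^{d e²} ≅ W^d`, `(W^d)^{d'} = W^{d d'}`, and (over `ℚ`, proof `sorry`) the twisting formula for
traces of Frobenius `a_p(E^d) = (d/p) a_p(E)` at primes `p ∤ 2 d Δ`.

Mathlib has no notion of quadratic twist (searched `twist`, `Twist` in Mathlib: no hits); it does
provide `WeierstrassCurve.VariableChange` (isomorphisms), `WeierstrassCurve.j` and `legendreSym`, which
we use.

## Design notes

* Declarations are deliberately placed in Mathlib's `WeierstrassCurve` namespace (dot notation on
  `W`), as fixed by the outline.
* The definition is total (it uses field division by `4` and `2`); it is only meaningful when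
  `(2 : F) ≠ 0`, and the API lemmas assume `[NeZero (2 : F)]` (automatic from `CharZero F`).
  In characteristic `2` the value is the junk curve `y² = x³` (all divisions by `4`, `2` are `0`).
* `j_quadraticTwist` takes `[(W.quadraticTwist d).IsElliptic]` as an instance hypothesis (supplied by
  `isElliptic_quadraticTwist` when `d ≠ 0`), mirroring Mathlib's `variableChange_j`.
* `frobeniusTrace_quadraticTwist` is phrased for two globally minimal equations `W, W'` over `ℚ` with
  `W'` `ℚ`-isomorphic to `W.quadraticTwist d`, because `W.quadraticTwist d` itself is in general not
  a minimal (or even integral) model; it uses `WeierstrassCurve.frobeniusTrace` from C12.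

## References

* J. H. Silverman, *The Arithmetic of Elliptic Curves*, GTM 106, 2nd ed. (2009), X.2 (Prop. 2.4 and
  the remark following it), X.5 (twists; Cor. 5.4), Exercise 10.16 / X.6.
* K. Rubin, A. Silverberg, *Ranks of elliptic curves*, Bull. AMS 39 (2002), §1.
-/

noncomputable section

open scoped Classical

/-! The declarations below extend Mathlib's `WeierstrassCurve` namespace (dot notation on `W`). -/
namespace WeierstrassCurve

section Field

variable {F : Type*} [Field F] (W : WeierstrassCurve F) (d : F)

/-- The *quadratic twist* `W^d` of a Weierstrass equation `W` over a field `F` (of characteristic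
`≠ 2`) by `d : F`: the Weierstrass equation `y² = x³ + d (b₂/4) x² + d² (b₄/2) x + d³ (b₆/4)`,
obtained from the completed-square model `y² = x³ + (b₂/4)x² + (b₄/2)x + b₆/4` of `W` by twisting
`d y² = …` and rescaling `(x, y) ↦ (d x, d² y)`. Over `F(√d)` it is isomorphic to `W`; for `d ≠ 0`
its isomorphism class depends only on `d` modulo squares. The definition is total but only
meaningful when `(2 : F) ≠ 0` (Silverman, *AEC* X.2, remark after Prop. 2.4, and X.5 Cor. 5.4(iii);
Rubin–Silverberg 2002, §1). [cite: RubinSilverberg2002, §1] -/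
def quadraticTwist : WeierstrassCurve F :=
  ⟨0, d * W.b₂ / 4, 0, d ^ 2 * W.b₄ / 2, d ^ 3 * W.b₆ / 4⟩

/-- `quadraticTwist_a₁` — interim lemma carried over undocumented from `harness21/H21/H21/Prelude/TranscendEllArithS/QuadraticTwist.lean:70` (docstring generated by the M5 import). [folklore] -/
@[simp]
lemma quadraticTwist_a₁ : (W.quadraticTwist d).a₁ = 0 := rfl

/-- `quadraticTwist_a₂` — interim lemma carried over undocumented from `harness21/H21/H21/Prelude/TranscendEllArithS/QuadraticTwist.lean:73` (docstring generated by the M5 import). [folklore] -/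
@[simp]
lemma quadraticTwist_a₂ : (W.quadraticTwist d).a₂ = d * W.b₂ / 4 := rfl

/-- `quadraticTwist_a₃` — interim lemma carried over undocumented from `harness21/H21/H21/Prelude/TranscendEllArithS/QuadraticTwist.lean:76` (docstring generated by the M5 import). [folklore] -/
@[simp]
lemma quadraticTwist_a₃ : (W.quadraticTwist d).a₃ = 0 := rfl

/-- `quadraticTwist_a₄` — interim lemma carried over undocumented from `harness21/H21/H21/Prelude/TranscendEllArithS/QuadraticTwist.lean:79` (docstring generated by the M5 import). [folklore] -/
@[simp]
lemma quadraticTwist_a₄ : (W.quadraticTwist d).a₄ = d ^ 2 * W.b₄ / 2 := rfl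

/-- `quadraticTwist_a₆` — interim lemma carried over undocumented from `harness21/H21/H21/Prelude/TranscendEllArithS/QuadraticTwist.lean:82` (docstring generated by the M5 import). [folklore] -/
@[simp]
lemma quadraticTwist_a₆ : (W.quadraticTwist d).a₆ = d ^ 3 * W.b₆ / 4 := rfl

/-- Twisting by `d e²` (`e ≠ 0`) gives a curve `F`-isomorphic to the twist by `d`: the isomorphism
class of `W^d` depends only on `d` modulo squares (Silverman, *AEC* X.2 Prop. 2.4, X.5 Cor. 5.4). [folklore] -/
theorem exists_variableChange_quadraticTwist_mul_sq (d e : F) (he : e ≠ 0) :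
    ∃ C : VariableChange F, C • W.quadraticTwist d = W.quadraticTwist (d * e ^ 2) := by
  refine ⟨⟨(Units.mk0 e he)⁻¹, 0, 0, 0⟩, ?_⟩
  ext
  · simp [variableChange_a₁]
  · simp only [variableChange_a₂, quadraticTwist_a₂, quadraticTwist_a₁, inv_inv, Units.val_mk0]
    ring
  · simp [variableChange_a₃]
  · simp only [variableChange_a₄, quadraticTwist_a₁, quadraticTwist_a₂, quadraticTwist_a₃,
      quadraticTwist_a₄, inv_inv, Units.val_mk0]
    ring
  · simp only [variableChange_a₆, quadraticTwist_a₁, quadraticTwist_a₂, quadraticTwist_a₃,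
      quadraticTwist_a₄, quadraticTwist_a₆, inv_inv, Units.val_mk0]
    ring

variable [NeZero (2 : F)]

/-- `4 ≠ 0` in a field with `2 ≠ 0` (auxiliary). [folklore] -/
private lemma four_ne_zero' : (4 : F) ≠ 0 := by
  rw [show (4 : F) = 2 * 2 by norm_num]
  exact mul_ne_zero two_ne_zero two_ne_zero

/-- `b₂(W^d) = d b₂(W)` (Silverman, *AEC* X.2, III.1). [folklore] -/
@[simp]
lemma quadraticTwist_b₂ : (W.quadraticTwist d).b₂ = d * W.b₂ := by
  have h4 := four_ne_zero' (F := F)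
  simp only [b₂, quadraticTwist_a₁, quadraticTwist_a₂]
  field_simp
  ring

/-- `b₄(W^d) = d² b₄(W)` (Silverman, *AEC* X.2, III.1). [folklore] -/
@[simp]
lemma quadraticTwist_b₄ : (W.quadraticTwist d).b₄ = d ^ 2 * W.b₄ := by
  have h2 : (2 : F) ≠ 0 := two_ne_zero
  simp only [b₄, quadraticTwist_a₁, quadraticTwist_a₃, quadraticTwist_a₄]
  field_simp
  ring

/-- `b₆(W^d) = d³ b₆(W)` (Silverman, *AEC* X.2, III.1). [folklore] -/
@[simp]
lemma quadraticTwist_b₆ : (W.quadraticTwist d).b₆ = d ^ 3 * W.b₆ := by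
  have h4 := four_ne_zero' (F := F)
  simp only [b₆, quadraticTwist_a₃, quadraticTwist_a₆]
  field_simp
  ring

/-- `b₈(W^d) = d⁴ b₈(W)` (Silverman, *AEC* X.2, III.1; uses `4 b₈ = b₂ b₆ - b₄²`). [folklore] -/
@[simp]
lemma quadraticTwist_b₈ : (W.quadraticTwist d).b₈ = d ^ 4 * W.b₈ := by
  have h4 := four_ne_zero' (F := F)
  have h2 : (2 : F) ≠ 0 := two_ne_zero
  simp only [b₈, quadraticTwist_a₁, quadraticTwist_a₂, quadraticTwist_a₃, quadraticTwist_a₄,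
    quadraticTwist_a₆, b₂, b₄, b₆]
  field_simp
  ring

/-- `c₄(W^d) = d² c₄(W)` (Silverman, *AEC* X.2, III.1). [folklore] -/
@[simp]
lemma quadraticTwist_c₄ : (W.quadraticTwist d).c₄ = d ^ 2 * W.c₄ := by
  simp only [c₄, quadraticTwist_b₂, quadraticTwist_b₄]
  ring

/-- `c₆(W^d) = d³ c₆(W)` (Silverman, *AEC* X.2, III.1). [folklore] -/
@[simp]
lemma quadraticTwist_c₆ : (W.quadraticTwist d).c₆ = d ^ 3 * W.c₆ := by
  simp only [c₆, quadraticTwist_b₂, quadraticTwist_b₄, quadraticTwist_b₆]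
  ring

/-- `Δ(W^d) = d⁶ Δ(W)`: the discriminant of the quadratic twist by `d` (in the model
`quadraticTwist`) is exactly `d⁶` times the discriminant (Silverman, *AEC* X.2, III.1). [folklore] -/
@[simp]
lemma quadraticTwist_Δ : (W.quadraticTwist d).Δ = d ^ 6 * W.Δ := by
  simp only [Δ, quadraticTwist_b₂, quadraticTwist_b₄, quadraticTwist_b₆, quadraticTwist_b₈]
  ring

/-- The quadratic twist of an elliptic curve by `d ≠ 0` is an elliptic curve
(Silverman, *AEC* X.5 Cor. 5.4). Not an instance (it needs the hypothesis `d ≠ 0`). [folklore] -/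
theorem isElliptic_quadraticTwist [W.IsElliptic] {d : F} (hd : d ≠ 0) :
    (W.quadraticTwist d).IsElliptic := by
  refine ⟨?_⟩
  rw [quadraticTwist_Δ]
  exact (IsUnit.mk0 _ (pow_ne_zero 6 hd)).mul W.isUnit_Δ

/-- The quadratic twist has the same `j`-invariant: `j(W^d) = j(W)` (Silverman, *AEC* X.5
Cor. 5.4 and III.1 Prop. 1.4(b)). The instance hypothesis is supplied by
`isElliptic_quadraticTwist`. [folklore] -/
theorem j_quadraticTwist [W.IsElliptic] {d : F} (hd : d ≠ 0) [(W.quadraticTwist d).IsElliptic] :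
    (W.quadraticTwist d).j = W.j := by
  have h6 : d ^ 6 ≠ 0 := pow_ne_zero 6 hd
  rw [j, j, Units.inv_mul_eq_iff_eq_mul, ← mul_assoc, quadraticTwist_c₄, coe_Δ', quadraticTwist_Δ,
    mul_assoc (d ^ 6), ← coe_Δ', Units.mul_inv]
  ring

/-- The twist by `1` is isomorphic to `W` over `F`: `C • W = W^1` for the change of variables
`C = (1, 0, -a₁/2, -a₃/2)` completing the square (Silverman, *AEC* III.1). [folklore] -/
theorem exists_variableChange_quadraticTwist_one :
    ∃ C : VariableChange F, C • W = W.quadraticTwist 1 := by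
  have h2 : (2 : F) ≠ 0 := two_ne_zero
  have h4 := four_ne_zero' (F := F)
  refine ⟨⟨1, 0, -W.a₁ / 2, -W.a₃ / 2⟩, ?_⟩
  ext
  · simp only [variableChange_a₁, quadraticTwist_a₁, inv_one, Units.val_one]
    field_simp
    ring
  · simp only [variableChange_a₂, quadraticTwist_a₂, b₂, inv_one, Units.val_one]
    field_simp
    ring
  · simp only [variableChange_a₃, quadraticTwist_a₃, inv_one, Units.val_one]
    field_simp
    ring
  · simp only [variableChange_a₄, quadraticTwist_a₄, b₄, inv_one, Units.val_one]
    field_simp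
    ring
  · simp only [variableChange_a₆, quadraticTwist_a₆, b₆, inv_one, Units.val_one]
    field_simp
    ring

/-- Twisting is multiplicative in this model: `(W^d)^{d'} = W^{d d'}` on the nose
(Silverman, *AEC* X.2, X.5). [folklore] -/
theorem quadraticTwist_quadraticTwist (d d' : F) :
    (W.quadraticTwist d).quadraticTwist d' = W.quadraticTwist (d * d') := by
  ext
  · rfl
  · simp only [quadraticTwist_a₂, quadraticTwist_b₂]
    ring
  · rfl
  · simp only [quadraticTwist_a₄, quadraticTwist_b₄]
    ring
  · simp only [quadraticTwist_a₆, quadraticTwist_b₆]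
    ring

end Field

section Rat

/-- **Twisting formula for traces of Frobenius.** Let `W` and `W'` be globally minimal Weierstrass
equations of elliptic curves over `ℚ` with `W'` `ℚ`-isomorphic to the quadratic twist of `W` by a
squarefree integer `d`. Then for every prime `p ∤ 2 d` of good reduction for `W`,
`a_p(W') = (d / p) · a_p(W)`, where `(d / p)` is the Legendre symbol
(Silverman, *AEC* X.2, X.6 and Exercise 10.16(c); Rubin–Silverberg 2002, §1). [cite: RubinSilverberg2002, §1] -/
def frobeniusTrace_quadraticTwist : Prop :=
  ∀ (W W' : WeierstrassCurve ℚ) [W.IsElliptic] [W.IsGloballyMinimal] [W'.IsGloballyMinimal] (d : ℤ) (hd : Squarefree d) (hW' : ∃ C : VariableChange ℚ, C • W' = W.quadraticTwist (d : ℚ)) (p : ℕ) [Fact p.Prime] (hpd : ¬ (p : ℤ) ∣ 2 * d) (hgood : ¬ (p : ℤ) ∣ W.minimalDiscriminantInt),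
    W'.frobeniusTrace p = legendreSym p d * W.frobeniusTrace p

end Rat

end WeierstrassCurve

end
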